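import Summits.AtomisticToContinuum.Crystallization.Theorems.SquareWellLayerCakeStackingFaultSparsityOffBoxDefs

/-!
# `StackingFaultSparsity` (stmt-AtomisticToContinuum-14296), line `Sketch`: kernel certificates of the
off-box scale gap, part 6 of 6 (stub `stub_offBoxGrid`)

Each theorem below evaluates the interval checker `obCheck p₁ p₂` of
`Theorems/SquareWellLayerCakeStackingFaultSparsityOffBoxDefs.lean` on one interval `[p₁, p₂]/10⁴` of the
certificate grid in `c = h/a` (116 consecutive intervals covering `[1/4, 4]`), by `decide +kernel`: the
structural floor-sum loops `hcpSumLoopI` (GMP arithmetic in the kernel, `46` layer sums of `441` terms at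
each end point) and exact `ℚ` arithmetic for the tails, the aggregates and the segment test.  About `10 s`
of kernel time per interval.  The grid (design script `numerics/cert_design2.py`, exact twin
`numerics/obcheck.py` in the lead folder) is finest just outside the box edges `c = 0.78`, `c = 0.85`
(steps `6·10⁻⁴`) where the margin of the scale gap is `≈ 5·10⁻³`.  All `[folklore]` certified numerics.
-/

namespace Summit.AtomisticToContinuum.Crystallization.Theorems.SquareWellLayerCake.StackingFaultSparsity

/-- Kernel certificate: the interval checker accepts `[8711, 8741]/10⁴`. [folklore] -/
theorem obCheck_8711_8741 : obCheck 8711 8741 = true := by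
  decide +kernel

/-- Kernel certificate: the interval checker accepts `[8741, 8781]/10⁴`. [folklore] -/
theorem obCheck_8741_8781 : obCheck 8741 8781 = true := by
  decide +kernel

/-- Kernel certificate: the interval checker accepts `[8781, 8831]/10⁴`. [folklore] -/
theorem obCheck_8781_8831 : obCheck 8781 8831 = true := by
  decide +kernel

/-- Kernel certificate: the interval checker accepts `[8831, 8891]/10⁴`. [folklore] -/
theorem obCheck_8831_8891 : obCheck 8831 8891 = true := by
  decide +kernel

/-- Kernel certificate: the interval checker accepts `[8891, 8971]/10⁴`. [folklore] -/
theorem obCheck_8891_8971 : obCheck 8891 8971 = true := by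
  decide +kernel

/-- Kernel certificate: the interval checker accepts `[8971, 9071]/10⁴`. [folklore] -/
theorem obCheck_8971_9071 : obCheck 8971 9071 = true := by
  decide +kernel

/-- Kernel certificate: the interval checker accepts `[9071, 9221]/10⁴`. [folklore] -/
theorem obCheck_9071_9221 : obCheck 9071 9221 = true := by
  decide +kernel

/-- Kernel certificate: the interval checker accepts `[9221, 9421]/10⁴`. [folklore] -/
theorem obCheck_9221_9421 : obCheck 9221 9421 = true := by
  decide +kernel

/-- Kernel certificate: the interval checker accepts `[9421, 9721]/10⁴`. [folklore] -/
theorem obCheck_9421_9721 : obCheck 9421 9721 = true := by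
  decide +kernel

/-- Kernel certificate: the interval checker accepts `[9721, 10221]/10⁴`. [folklore] -/
theorem obCheck_9721_10221 : obCheck 9721 10221 = true := by
  decide +kernel

/-- Kernel certificate: the interval checker accepts `[10221, 15221]/10⁴`. [folklore] -/
theorem obCheck_10221_15221 : obCheck 10221 15221 = true := by
  decide +kernel

/-- Kernel certificate: the interval checker accepts `[15221, 20221]/10⁴`. [folklore] -/
theorem obCheck_15221_20221 : obCheck 15221 20221 = true := by
  decide +kernel

/-- Kernel certificate: the interval checker accepts `[20221, 25221]/10⁴`. [folklore] -/
theorem obCheck_20221_25221 : obCheck 20221 25221 = true := by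
  decide +kernel

/-- Kernel certificate: the interval checker accepts `[25221, 30221]/10⁴`. [folklore] -/
theorem obCheck_25221_30221 : obCheck 25221 30221 = true := by
  decide +kernel

/-- Kernel certificate: the interval checker accepts `[30221, 35221]/10⁴`. [folklore] -/
theorem obCheck_30221_35221 : obCheck 30221 35221 = true := by
  decide +kernel

/-- Kernel certificate: the interval checker accepts `[35221, 40000]/10⁴`. [folklore] -/
theorem obCheck_35221_40000 : obCheck 35221 40000 = true := by
  decide +kernel

end Summit.AtomisticToContinuum.Crystallization.Theorems.SquareWellLayerCake.StackingFaultSparsity
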